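import Summits.QuantumFields.YangMills.Theorems.BalabanLadderIRStubRungStrong
import HarnessLib

/-!
# Gauge-image blindness of Wilson DLR kernels — definitions

Vocabulary for the gauge-orbit blindness lemmas of crux `stmt-QuantumFields-19354` (`BalabanLadder.IR`),
typed by the crux-ideate seat ym-cruxidea-19354-2 (gen 3, card `orbit-blind-collars-locate-the-row`,
`Sketch-g3.lean` sha16 47d20d20eb75f8bf, evidence #46 on the item) and landed as count-neutral helper
modules under owner READING R44 («(C1)–(C3) MAY LAND as count-neutral helpers»).

This module is ROUTE-INDEPENDENT: it imports only the Theses-free IR cell vocabulary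
(`Cruxes.IR.Tempered.cellEdges`) and the Literature DLR kernels.

* `IsEndpt e x` — `x` is an endpoint of the edge `e`;
* `Touches E x` — `x` is an endpoint of some edge of `E`;
* `restrictGauge E g` — the gauge transformation `g` restricted to the sites touched by `E`;
* `twistFn t₀ h` — the LAYER gauge transformation (`h` strictly above the layer `x 0 = t₀`, `1` on and below);
* `notTopReaching w`, `notBottomTouching w` — the centre-cell edges not reaching the top face, resp. not touching
  the bottom face, of the centre cell of the frame `w`.

The theorems live in `Theorems/BalabanLadderIRGaugeImageBlind.lean` (interior gauge invariance, collar blindness)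
and `Theorems/BalabanLadderIRGaugeImageBlindLayer.lean` (one-sided blindness, the sandwich channel, the observable
side).
-/

noncomputable section

open Literature.MathematicalPhysics.QuantumLattice
open Literature.Probability.LatticeModels (Site)
open Summit.QuantumFields.YangMills.Cruxes.IR.Tempered (cellEdges)

namespace Summit.QuantumFields.YangMills.Cruxes.IR.CruxIdea2g3

/-- Edges of `ℤ⁴`. -/
abbrev Edge := Literature.MathematicalPhysics.QuantumLattice.ZdEdge 4

/-- `x` is an endpoint of the edge `e = (y, i)`: `x = y` or `x = y + e_i`. -/
def IsEndpt (e : Edge) (x : Site 4) : Prop := x = e.1 ∨ x = e.1 + Pi.single e.2 1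

/-- `x` is an endpoint of some edge of `E`. -/
def Touches (E : Finset Edge) (x : Site 4) : Prop := ∃ e ∈ E, IsEndpt e x

section Gauge

variable {G : Type} [Group G]

open Classical in
/-- The gauge transformation `g` restricted to the sites touched by `E` (trivial elsewhere). -/
def restrictGauge (E : Finset Edge) (g : Site 4 → G) : Site 4 → G := fun x => if Touches E x then g x else 1

/-- The LAYER gauge transformation: `h` strictly above the layer `x 0 = t₀`, `1` on and below it. -/
def twistFn (t₀ : ℤ) (h : G) : Site 4 → G := fun x => if t₀ < x 0 then h else 1

end Gauge

/-- Centre-cell edges that do NOT reach the top face `x 0 = w 0 1` (everything except the top layer of normal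
links). -/
def notTopReaching (w : Fin 4 → ℤ → ℤ) : Finset Edge :=
  (cellEdges w 0).filter fun e => ¬ (e.2 = 0 ∧ e.1 0 + 1 = w 0 1)

/-- Centre-cell edges that do NOT touch the bottom face `x 0 = w 0 0` (edges based strictly above it). -/
def notBottomTouching (w : Fin 4 → ℤ → ℤ) : Finset Edge :=
  (cellEdges w 0).filter fun e => w 0 0 < e.1 0

end Summit.QuantumFields.YangMills.Cruxes.IR.CruxIdea2g3

end
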